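import Literature.Algebra.Lie.QuaternionCentralizerSkewDimensionForm
import HarnessLib

/-!
# The unitary count: `2 · dim_K (C(i) ∩ 𝔰𝔭(W, B)) = dim_K C(i)` for a `B`-skew `i` with `i² = a ≠ 0`

Topic `Literature/Algebra/Lie`.  Theorems only (no definition, no named fact), Mathlib vocabulary.  For a nondegenerate
antisymmetric bilinear form `B` on a finite-dimensional `K`-space `W` (`char K = 0`) and a `B`-SKEW endomorphism `i` with
`i² = a`, `a ∈ K×`, the `B`-adjoint anti-involution `τ` preserves the centraliser `C(i)` (`τ i = -i`), `C(i)` splits into its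
`τ`-symmetric and `τ`-skew (= `B`-skew) parts, and LEFT MULTIPLICATION BY `i` exchanges the two parts injectively; hence
**`2 · dim_K (C(i) ∩ 𝔰𝔭(W, B)) = dim_K C(i)`**.  When `K(i) = K[x]/(x² − a)` is a field (e.g. `a` totally negative in a totally real
`K`), `C(i) = End_{K(i)}(W)` has `K`-dimension `2m²` (`m = dim_{K(i)} W`) and `C(i) ∩ 𝔰𝔭(W, B)` is the unitary Lie algebra
`𝔲_m(K(i)/K)` of the hermitian form attached to `B`, of `K`-dimension `m²` — the Lefschetz Lie algebra of an abelian variety of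
Albert type IV with commutative endomorphism algebra (Milne 1999 §2: `C(A) = U`), written for the cell `pub-hodgecm2` (COR-CM),
seat `b27`, count-neutral Mumford–Tate-rank lane.

* **`two_mul_finrank_centralizer_inf_skewAdjoint`** — the count.

## References
* [Milne1999LefschetzClasses] J. S. Milne, *Lefschetz classes on abelian varieties*, Duke Math. J. 96 (1999), §2 (type IV, `d = 1`:
  the centraliser of `E` in `Sp` is the unitary group of the hermitian form `φ` with `ψ = Tr_{E/ℚ}(f φ)`).
* [Humphreys1972] J. E. Humphreys, GTM 9 (1972), §1.2.
-/

namespace Literature.Algebra.Lie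

namespace UnitaryCentralizerForm

open Module

variable {K : Type*} [Field K] [CharZero K] {W : Type*} [AddCommGroup W] [Module K W] [FiniteDimensional K W]

/-- **`2 · dim_K (C(i) ∩ 𝔰𝔭(W, B)) = dim_K C(i)`** for a nondegenerate antisymmetric `B`, a `B`-skew `i` with `i² = a ≠ 0`:
`C(i) = (C(i) ∩ Sym_τ) ⊕ (C(i) ∩ Skew_τ)` for the `B`-adjoint anti-involution `τ` (`τ i = -i`, so `τ C(i) = C(i)`), and
`X ↦ iX` maps each summand injectively into the other (`τ(iX) = τX · τi = ∓ X i = ∓ iX`, `i` invertible).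
[cite: Milne1999LefschetzClasses, §2] [cite: Humphreys1972, §1.2] -/
theorem two_mul_finrank_centralizer_inf_skewAdjoint (B : LinearMap.BilinForm K W) (hB : B.Nondegenerate) (hflip : B.flip = -B)
    {i : Module.End K W} {a : K} (ha : a ≠ 0) (hi : i * i = algebraMap K (Module.End K W) a) (hiskew : B.IsSkewAdjoint i) :
    2 * finrank K ↥(Subalgebra.toSubmodule (Subalgebra.centralizer K ({i} : Set (Module.End K W))) ⊓ B.skewAdjointSubmodule) =
      finrank K ↥(Subalgebra.toSubmodule (Subalgebra.centralizer K ({i} : Set (Module.End K W)))) := by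
  classical
  obtain ⟨τ, hτadj, hτmul, hττ, hker⟩ := QuaternionCentralizerForm.exists_adjoint_antiInvolution B hB hflip
  -- `τ i = -i`
  have hτi : τ i = -i := by
    have h : i ∈ LinearMap.ker (τ + LinearMap.id) := by
      rw [hker, LinearMap.mem_skewAdjointSubmodule]; exact hiskew
    rw [LinearMap.mem_ker, LinearMap.add_apply, LinearMap.id_apply, add_eq_zero_iff_eq_neg] at h
    exact h
  -- the three subspaces
  set C : Submodule K (Module.End K W) :=
    Subalgebra.toSubmodule (Subalgebra.centralizer K ({i} : Set (Module.End K W))) with hC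
  have hmemC : ∀ X, X ∈ C ↔ i * X = X * i := fun X => by
    rw [hC, Subalgebra.mem_toSubmodule, Subalgebra.mem_centralizer_iff]
    simp only [Set.mem_singleton_iff, forall_eq]
  set Sp : Submodule K (Module.End K W) := C ⊓ LinearMap.ker (τ - LinearMap.id) with hSp
  set Sm : Submodule K (Module.End K W) := C ⊓ B.skewAdjointSubmodule with hSm
  have hmemSp : ∀ X, X ∈ Sp ↔ X ∈ C ∧ τ X = X := fun X => by
    rw [hSp, Submodule.mem_inf, LinearMap.mem_ker, LinearMap.sub_apply, LinearMap.id_apply, sub_eq_zero]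
  have hmemSm : ∀ X, X ∈ Sm ↔ X ∈ C ∧ τ X = -X := fun X => by
    rw [hSm, Submodule.mem_inf, ← hker, LinearMap.mem_ker, LinearMap.add_apply, LinearMap.id_apply, add_eq_zero_iff_eq_neg]
  -- `τ` preserves `C`
  have hτC : ∀ X ∈ C, τ X ∈ C := fun X hX => by
    rw [hmemC] at hX ⊢
    have h := congrArg τ hX
    rw [hτmul, hτmul, hτi, mul_neg, neg_mul, neg_inj] at h
    exact h.symm
  -- `C = Sp ⊔ Sm`, `Sp ⊓ Sm = ⊥`
  have hsup : Sp ⊔ Sm = C := by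
    refine le_antisymm (sup_le inf_le_left inf_le_left) fun X hX => ?_
    have h1 : ((2 : K)⁻¹ • (X + τ X)) ∈ Sp := by
      rw [hmemSp]
      refine ⟨C.smul_mem _ (C.add_mem hX (hτC X hX)), ?_⟩
      rw [map_smul, map_add, hττ, add_comm]
    have h2 : ((2 : K)⁻¹ • (X - τ X)) ∈ Sm := by
      rw [hmemSm]
      refine ⟨C.smul_mem _ (C.sub_mem hX (hτC X hX)), ?_⟩
      rw [map_smul, map_sub, hττ, ← smul_neg, neg_sub]
    have hX' : X = (2 : K)⁻¹ • (X + τ X) + (2 : K)⁻¹ • (X - τ X) := by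
      rw [← smul_add, add_add_sub_cancel, ← two_smul K X, smul_smul, inv_mul_cancel₀ (two_ne_zero' K), one_smul]
    rw [hX']
    exact Submodule.add_mem_sup h1 h2
  have hinf : Sp ⊓ Sm = ⊥ := by
    rw [Submodule.eq_bot_iff]
    intro X hX
    obtain ⟨hp, hm⟩ := Submodule.mem_inf.1 hX
    have h1 := ((hmemSp X).1 hp).2
    have h2 := ((hmemSm X).1 hm).2
    rw [h1] at h2
    have h3 : (2 : K) • X = 0 := by rw [two_smul, ← eq_neg_iff_add_eq_zero]; exact h2
    exact (smul_eq_zero.1 h3).resolve_left (two_ne_zero' K)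
  have hdim : finrank K Sp + finrank K Sm = finrank K C := by
    have h := Submodule.finrank_sup_add_finrank_inf_eq Sp Sm
    rw [hsup, hinf, finrank_bot, add_zero] at h
    exact h.symm
  -- left multiplication by `i` is injective and exchanges `Sp` and `Sm`
  set μ : Module.End K W →ₗ[K] Module.End K W := LinearMap.mulLeft K i with hμ
  have hμinj : Function.Injective μ := by
    intro X Y h
    change i * X = i * Y at h
    have h' : i * i * X = i * i * Y := by rw [mul_assoc, h, ← mul_assoc]
    rw [hi, Algebra.algebraMap_eq_smul_one, smul_mul_assoc, one_mul, smul_mul_assoc, one_mul] at h'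
    exact smul_right_injective (Module.End K W) ha h'
  have hμC : ∀ X ∈ C, μ X ∈ C := fun X hX => by
    rw [hmemC] at hX ⊢
    change i * (i * X) = i * X * i
    rw [mul_assoc, hX]
  have hμpm : Sp.map μ ≤ Sm := by
    rintro _ ⟨X, hX, rfl⟩
    obtain ⟨hXC, hXτ⟩ := (hmemSp X).1 hX
    rw [hmemSm]
    refine ⟨hμC X hXC, ?_⟩
    change τ (i * X) = -(i * X)
    rw [hτmul, hXτ, hτi, mul_neg, ← (hmemC X).1 hXC]
  have hμmp : Sm.map μ ≤ Sp := by
    rintro _ ⟨X, hX, rfl⟩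
    obtain ⟨hXC, hXτ⟩ := (hmemSm X).1 hX
    rw [hmemSp]
    refine ⟨hμC X hXC, ?_⟩
    change τ (i * X) = i * X
    rw [hτmul, hXτ, hτi, mul_neg, neg_mul, neg_neg, ← (hmemC X).1 hXC]
  have h1 : finrank K Sp ≤ finrank K Sm :=
    (LinearEquiv.finrank_eq (Submodule.equivMapOfInjective μ hμinj Sp)).le.trans (Submodule.finrank_mono hμpm)
  have h2 : finrank K Sm ≤ finrank K Sp :=
    (LinearEquiv.finrank_eq (Submodule.equivMapOfInjective μ hμinj Sm)).le.trans (Submodule.finrank_mono hμmp)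
  omega

end UnitaryCentralizerForm

end Literature.Algebra.Lie
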